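import Summits.CriticalPhenomena.SAWScalingLimit.Theses.SAWRestrictionRigidity
import Literature.Probability.RandomPlanarGeometry.ChordalRestrictionMarkov
import Literature.Probability.RandomPlanarGeometry.ChordalReversibility
import Literature.Probability.RandomPlanarGeometry.LatticeSimilarityCovariance
import Literature.Probability.RandomPlanarGeometry.RadoContinuity

/-!
# `Rigidity` as typed = (repaired crux C′) ∧ (the axioms force Radó continuity) — crux stmt-CriticalPhenomena-1368, route SAWRestrictionRigidity

Target: `Summits/CriticalPhenomena/SAWScalingLimit/Theorems/SAWRestrictionRigidityRigidityIffRepairAndRado.lean`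
(`--supports stmt-CriticalPhenomena-1368`; lead c4 of line `registered`, 2026-08-17).

Two consecutive line leads (c3, c4) return `verdict: misstated` on the crux as typed and recommend
the restatement C′ = "the seven lattice-exact axioms AND Radó continuity of `D ↦ P D`
(`ChordalFamily.IsRadoContinuous`, the conclusion of item stmt-CriticalPhenomena-7305) imply conformal
covariance" (crux workfile `Cruxes/Rigidity/Repair.lean`, where C′ is typed inline as `RigidityC` and
the repaired deciding theorem `closesC` is checked). This file is the kernel-checked content of that
verdict, in the tree's PACKAGED vocabulary (`IsRestrictionMarkov`, `IsReversible`,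
`IsLatticeSimilarityCovariant`, `IsCarriedBySimpleCurves`, `IsRadoContinuous` — each definitionally
the clause inlined in the route file): the typed crux is EQUIVALENT to the conjunction of

* C′ (first conjunct): chordal + restriction + restriction–Markov + reversible + lattice-similarity
  covariant + simple boundary-avoiding + Radó-continuous ⇒ conformally covariant, and
* `AxiomsForceRado` (second conjunct): EVERY chordal family with the seven axioms is Radó-continuous
  — a pure regularity statement about axiomatic families, with no self-avoiding walk in it, which is
  exactly what the domain-keyed candidate counterexamples (crux idea `Ideas/texture-keyed-modulus.md`;
  `Cruxes/Rigidity/AUDIT-c4.md` §3) would violate and what no SAW route needs (the SAW limit gets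
  Radó continuity from stmt-7305 directly).

The proof is two lines each way through the tree theorem
`ChordalFamily.IsConformallyCovariant.isRadoContinuous_of_isChordal` (RadoContinuity.lean: conformal
covariance transports the law along `Φₙ → Φ`, dominated convergence on the compact traces). So
restating the item as C′ discards precisely `AxiomsForceRado`, and a refutation of the typed crux that
is not a refutation of C′ is the same thing as a non-Radó-continuous family with the seven axioms
(the contrapositive `Rigidity_false_of_NonRadoAxiomsFamily` is filed separately under
`Theorems/Rigidity/Negative/`, negative lane modulo the construction `NonRadoAxiomsFamily`).
-/

namespace Summit.CriticalPhenomena.SAWScalingLimit.Cruxes.Rigidity.Repair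

open MeasureTheory
open Literature.Probability.RandomPlanarGeometry

/-- **The typed crux forces regularity.** `Rigidity` as typed implies that every chordal family with the seven lattice-exact axioms (restriction, restriction-coupled Markov kernel `IsRestrictionMarkov`, reversal `IsReversible`, covariance under `z ↦ r iᵏ z + w` and under conjugation `IsLatticeSimilarityCovariant`, simple boundary-avoiding curves `IsCarriedBySimpleCurves`) is Radó-continuous in the domain — because its conclusion, conformal covariance, already is (`IsConformallyCovariant.isRadoContinuous_of_isChordal`). The packaged notions are definitionally the clauses inlined in the route file. This is the part of the typed crux that has nothing to do with the self-avoiding walk. [folklore] -/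
theorem rado_of_rigidity (hR : Summit.CriticalPhenomena.SAWScalingLimit.Theses.SAWRestrictionRigidity.Rigidity) :
    ∀ P : Literature.Probability.RandomPlanarGeometry.ChordalFamily, P.IsChordal → P.IsRestriction → P.IsRestrictionMarkov → P.IsReversible → P.IsLatticeSimilarityCovariant → P.IsCarriedBySimpleCurves → P.IsRadoContinuous := by
  intro P hch hres hRM hrev hLS hS
  exact (hR P hch hres hRM hrev hLS.1 hLS.2 hS).isRadoContinuous_of_isChordal hch

/-- **`Rigidity` as typed ↔ C′ ∧ AxiomsForceRado** (kernel-checked content of the `misstated` verdict of leads c3/c4): the crux as typed is equivalent to the conjunction of the REPAIRED crux C′ (the seven axioms plus Radó continuity `ChordalFamily.IsRadoContinuous` — verbatim the conclusion of item stmt-CriticalPhenomena-7305 — imply conformal covariance; packaged form of `Cruxes/Rigidity/Repair.lean`'s `RigidityC`) and of the SAW-free regularity statement "every chordal family with the seven axioms is Radó-continuous". `→`: C′ has one more hypothesis; regularity by `rado_of_rigidity`. `←`: feed the regularity conjunct into C′. [folklore] -/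
theorem rigidity_iff_repair_and_rado :
    Summit.CriticalPhenomena.SAWScalingLimit.Theses.SAWRestrictionRigidity.Rigidity ↔
      ((∀ P : Literature.Probability.RandomPlanarGeometry.ChordalFamily, P.IsChordal → P.IsRestriction → P.IsRestrictionMarkov → P.IsReversible → P.IsLatticeSimilarityCovariant → P.IsCarriedBySimpleCurves → P.IsRadoContinuous → P.IsConformallyCovariant) ∧ (∀ P : Literature.Probability.RandomPlanarGeometry.ChordalFamily, P.IsChordal → P.IsRestriction → P.IsRestrictionMarkov → P.IsReversible → P.IsLatticeSimilarityCovariant → P.IsCarriedBySimpleCurves → P.IsRadoContinuous)) := by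
  constructor
  · intro hR
    exact ⟨fun P hch hres hRM hrev hLS hS _ => hR P hch hres hRM hrev hLS.1 hLS.2 hS,
      rado_of_rigidity hR⟩
  · rintro ⟨hC, hRado⟩ P hch hres hmk hrev hsim hconj hsimple
    exact hC P hch hres hmk hrev ⟨hsim, hconj⟩ hsimple
      (hRado P hch hres hmk hrev ⟨hsim, hconj⟩ hsimple)

end Summit.CriticalPhenomena.SAWScalingLimit.Cruxes.Rigidity.Repair
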